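import Summits.QuantumFields.YangMills.Theorems.BalabanUVNodesN22AtRecordOfActivityReadingLastSchemas
import Summits.QuantumFields.YangMills.Theorems.BalabanUVNodesN22AtRecordOfTermDataTableGerms

/-!
# BalabanUVNodes ∕ node N22 = NE9 — K3's `h9` ON ROAD 2 FOR def-W1's (2.14) TERM DATA READ ON NODE N10's TABLE-GERM CARRIER WITH THE LAST COUPLING CARRIED BY REAL-COUPLING
# SCHEMAS (schema-form twins of module J68 §1 ∕ §2): the N10 → N22 junction exactly as in J68 (module 102 §4's activity triple along the canonical section, module 105's all-level
# domination rows, the level-`0` device `AdmHist ∧ old 0 = 0`, module 106's reading block from def-W1's laws), composed on J84B instead of J66 §2 — the last-coupling side of the bill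
# is J62 §3's schemas `hGt ∕ hG2last` of `(𝔇 K).Gn` AT REAL WINDOW COUPLINGS (generic `lam ≤ ℓ₁`, `lam₂ ≤ ℓ₂`), not a sector datum on the datum's raw complex-coupling display

Cell `pub-ymgap`, HUMAN RULING D-0062 (Track A), R134 seat `pub-ymgap-dag-n22-c` (strategy s1: «the history-Lipschitz estimate (2.40)–(2.41) p. 21 of [II] on the W1 object»), generation
20, module J84C.  THEOREMS ONLY (no `def`, no `sorry`, standard axioms); `--kind proof --supports stmt-QuantumFields-27366 --as helper` (K3⁸ `SpineGivenEndpointR13SepCoPHV`), COUNT-NEUTRAL.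
Imports this lane's module J84B `…N22AtRecordOfActivityReadingLastSchemas` and module J68 `…N22AtRecordOfTermDataTableGerms` (for node N10's modules 102 ∕ 105 ∕ 106 by name).  Nothing
re-declared; J68 §1 ∕ §2's proofs verbatim with the schemas passed through.

WHY.  See modules J84A ∕ J80A: at def-W1's term data the honest holomorphic object in the last coupling is the CONTINUED term family (`TermData214.continuedTF`), whose generator agrees
with `(𝔇 K).Gn` at real couplings only; real-coupling schemas transport along that agreement, a sector datum on `z ↦ ((𝔇 K).Gn k).E z old φ X` does not.  This file carries the
table-germ junction of g19 over to the schema form: §1 (J68 §1's twin) reading section `hcv` and per-term row `hT` displayed; §2 (J68 §2's twin) `hcv` DISCHARGED from def-W1's laws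
(`UnscaledFieldLawOn`, `ReadsBy`, `MapsToTables … univ` on windows `W ⊇ sp`) by module 106 `𝒱_tableGerms_reading`.
* §1 ★★★ `ne9_EA_objectsOfRecord₁₃_of_kernelStepRate_termDataTableGermsLastSchemasNonexpansive` — binder diff vs J68 §1: `O V hcS hBq hballS hholS hbdS` OUT; `hGt hlam hℓ₁ hG2last hlam₂
  hℓ₂` IN (schemas of `((𝔇 K).Gn k).E` on the class `AdmHist (sp K) E₀ r₁ k ∧ old 0 = 0`, table `sp K (k+1) X`, rate `κ_E`); `hC₉` at the generic `M₂`.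
* §2 ★★★ `ne9_EA_objectsOfRecord₁₃_of_kernelStepRate_termDataTableGermsLawsLastSchemasNonexpansive` — the same diff vs J68 §2.

HONEST FRAMING (binding).  Count-neutral COMPOSITION of tree theorems BY NAME (J84B; N10 modules 102 §4, 105, 106); the schemas, the reading section ∕ laws, the per-term row `hT`,
`RecAdmissible`, the chart data, the numerics and every other binder are DISPLAYED HYPOTHESES; NO estimate of Bałaban's is proved or asserted; nothing of the record is constructed
or claimed to meet the displayed inputs.  N18, N10 and N22 are NOT discharged (typed 28∕28; count 7∕27 per dag-lead TABLE — N22 unchanged); K3⁸ OPEN and NOT claimed; NE9 ∕ NE5 NOT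
IN PRINT for d = 4; no count claim; one finite 𝕋⁴ programme at fixed ε — R4 closes the CONDITIONAL rung `BalabanLadder.UV` only; NOTHING about the continuum limit, ℝ⁴, infinite volume,
OS axioms, a mass gap or the Clay problem is proved or claimed.  References (TYPES only): [II] = Bałaban, CMP 116 (1988) (1.41) p. 11, (2.9)–(2.15) pp. 14–15, (2.16)–(2.22) p. 16,
(2.26) p. 17, Lemma 3 (2.38) p. 20, (2.39)–(2.41) p. 21; [I] = CMP 109 (1987) (0.23)–(0.24) pp. 256–257, Thm 1 p. 259, (1.17)–(1.18) p. 263, p. 266, (2.9)–(2.13) pp. 266–268;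
Kotecký–Preiss, CMP 103 (1986) Thm p. 492, p. 493; King, CMP 102 (1986) Lemma 4.5 (4.38).
-/

noncomputable section

open Set Metric
open scoped BigOperators

namespace YMDAG.N22.KernelFading

open Literature.MathematicalPhysics.QuantumFieldTheory.Balaban1983to89
open Literature.MathematicalPhysics.QuantumFieldTheory.Balaban1983to89.T4Continuum (T4Family ULoop)
open Literature.MathematicalPhysics.QuantumFieldTheory.Balaban1983to89.T4OutputRate (Window NE9)
open Literature.MathematicalPhysics.QuantumFieldTheory.Balaban1983to89.TreeLengthTorus (TPt TDom tsys torusTreeLen)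
open Literature.MathematicalPhysics.QuantumFieldTheory.Balaban1983to89.B12TreeDecay (K₀ kappa₀)
open Literature.MathematicalPhysics.QuantumFieldTheory.Balaban1983to89.B12Decay510 (delta1)
open Literature.MathematicalPhysics.QuantumFieldTheory.Balaban1983to89.B12Decay510Window (K₁)
open Literature.MathematicalPhysics.QuantumFieldTheory.Balaban1983to89.B12Decay510Torus (distCT nearT)
open Literature.MathematicalPhysics.QuantumFieldTheory.Balaban1983to89.B13Lemma3TorusData (TBond)
open Literature.MathematicalPhysics.QuantumFieldTheory.Balaban1983to89.B13Lemma3TorusTerms (terms weight)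
open Literature.MathematicalPhysics.QuantumFieldTheory.Balaban1983to89.B13Lemma3TorusSocket (Lemma3Numerics)
open Literature.MathematicalPhysics.QuantumFieldTheory.Balaban1983to89.B13OlderTermsTableGerms (Pot cv ρ norm_ρ_le_of_admHist norm_ρ_sub_ρ_le
  norm_ρ_threePoint_le)
open Literature.MathematicalPhysics.QuantumFieldTheory.Balaban1983to89.Node00 (Stage13Params Stage13HParams U3Letters₁₁ MatA)
open Literature.MathematicalPhysics.QuantumFieldTheory.Balaban1983to89.Node00.Sect2 (domSys domCount CPair)
open Literature.MathematicalPhysics.QuantumFieldTheory.Balaban1983to89.Node00.W1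
open Literature.MathematicalPhysics.QuantumFieldTheory.Balaban1983to89.Node00.LocalizedSum17 (ReadingMaps Localizes17OfRecord₁₃)
open Literature.MathematicalPhysics.QuantumFieldTheory.Balaban1983to89.Node00.U3OfKernels (histPrefix objectsOfRecord₁₃)
open Literature.MathematicalPhysics.QuantumFieldTheory.Balaban1983to89.Node00.U3KernelLetters (KernelStepRateOfRecord₁₃ PolLimitsExistOfRecord₁₃)
open YMDAG.UVSplit (N22At u3OfRecord₁₃ RateReading₁₃CoPH rateCarriersOfRecord₁₃CoPH)
open YMDAG.N22.AtKernels (n22At_u3OfRecord₁₃_objectsOfRecord₁₃_iff)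
open YMDAG.N10 (activityReading_termData_of_termwise226 𝒱_tableGerms_reading)

open scoped Matrix.Norms.L2Operator

variable (F : T4Family) (N : ℕ) [NeZero N] {𝔸 : Type} [NormedRing 𝔸] [NormedAlgebra ℂ 𝔸]

/-! ## §1 ★★★ schema-form twin of `ne9_EA_objectsOfRecord₁₃_of_kernelStepRate_termDataTableGermsNonexpansive` -/

open Classical Finset in
/-- ★★★ **K3's `h9` ON ROAD 2 FOR def-W1's TERM DATA ON N10's TABLE-GERM CARRIER, REAL-COUPLING LAST SCHEMAS** (schema-form twin of module J68 §1): module J84B at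
`Gn K := (𝔇 K).Gn`, `Adm := AdmHist (sp K) E₀ r₁ k ∧ old 0 = 0`, `Pot := Pot k (sp K)`, `ρA := ρ (sp K) κ_E (aw K k ·)`, `Ah := Σ_{s ∈ terms} (𝔇 K k).TF Z s t (cv p) φ` with
`hHA hAh hmaj` := N10 module 102 §4 (reading section `hcv` + per-term row `hT`), `hAdmr hρ₁ hρ₂` := module 105's all-level rows (level-`0` entries vanish on the class), (Adm-run) :=
`RecAdmissible` + `recTerm_zero`; the last coupling by the displayed schemas `hGt hlam hℓ₁ hG2last hlam₂ hℓ₂` of `((𝔇 K).Gn k).E` at real couplings.  LOCATED; N22 NOT discharged. [folklore] -/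
theorem ne9_EA_objectsOfRecord₁₃_of_kernelStepRate_termDataTableGermsLastSchemasNonexpansive (θ : Stage13Params F N) (ℓ : U3Letters₁₁) (hs : ℓ.Signs) (hγ : 0 < θ.γ)
    (hlim : PolLimitsExistOfRecord₁₃ F N θ) {κ₅ C₅ : ℝ} (hC₅ : 0 ≤ C₅) (h5 : KernelStepRateOfRecord₁₃ F N θ κ₅ ℓ.θ₅ C₅)
    (m' : ℕ) (M : ℕ) [NeZero M] (hM : M = F.L ^ m')
    {c₀ : B13.Consts} {L : ℕ} [NeZero L] (𝔇 : (K : ℕ) → TermData214 c₀ (F.P K) 𝔸 M L) (emb : ReadingMaps F (MatA N) 𝔸)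
    (hloc : Localizes17OfRecord₁₃ F N θ (fun K => truncRun K (toClusterTower (𝔇 K).Gn)) emb)
    (sp : (K j : ℕ) → (domSys (F.P K) M j).Dom → Set (CPair (F.P K) 𝔸))
    (hsp : ∀ (K j : ℕ) (Y : (domSys (F.P K) M j).Dom), IsOpen (sp K j Y))
    {κ κE δ₀ B₃ r R E₀ ϱ Mb cw ℓ₁ ℓ₂ r₁ : ℝ} {aw : ℕ → ℕ → ℕ → ℝ} {lam lam₂ : ℕ → ℕ → ℝ}
    (hκ₀ : kappa₀ (4 * 2 ^ 4) (2 * 4) ≤ κ / 2) (hδ₀ : 0 < δ₀) (hB₃ : 0 ≤ B₃) (hr : 0 < r) (hκE : κ ≤ κE) (hE₀ : 0 ≤ E₀)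
    {D : ℕ → Set ℂ} (hRA : ∀ K, RecAdmissible (𝔇 K).Gn (D K) (AdmHist (sp K) E₀ r₁))
    (hD : ∀ K, ∀ t ∈ Ioc (0 : ℝ) θ.γ, ((t : ℝ) : ℂ) ∈ D K)
    (hcv : ∀ (K k : ℕ), ∀ t ∈ Ioc (0 : ℝ) θ.γ, ∀ (old : OlderTerms (F.P K) 𝔸 M k), old ∈ AdmHist (sp K) E₀ r₁ k →
      ∀ (X : (domSys (F.P K) M (k + 1)).Dom), ∀ φ ∈ sp K (k + 1) X, ∀ Z : (domSys (F.P K) M (k + 1)).Dom, Subtype.val Z ⊆ Subtype.val X → ∀ s ∈ terms L M Z,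
        ∀ Y B, (𝔇 K k).𝒱 Z s ((t : ℝ) : ℂ) (cv κE (fun j : Fin (k + 1) => aw K k j) (ρ (sp K) κE (fun j : Fin (k + 1) => aw K k j) old)) φ Y B =
          (𝔇 K k).𝒱 Z s ((t : ℝ) : ℂ) old φ Y B)
    (c : B13.Consts) (hL : 8 ≤ c.L) (hLc : c.L = L) {a a₂ a₂' a₅ Aabs : ℝ} (hN : Lemma3Numerics c M ((c.L : ℝ) / 2) a a₂ a₂' a₅ Aabs)
    (hT : ∀ (K k : ℕ), ∀ t ∈ Ioc (0 : ℝ) θ.γ, ∀ (X : (domSys (F.P K) M (k + 1)).Dom), ∀ φ ∈ sp K (k + 1) X,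
      ∀ Z : (domSys (F.P K) M (k + 1)).Dom, Subtype.val Z ⊆ Subtype.val X → ∀ s ∈ terms L M Z,
        DifferentiableOn ℂ (fun p : Pot k (sp K) => (𝔇 K k).TF Z s ((t : ℝ) : ℂ) (cv κE (fun j : Fin (k + 1) => aw K k j) p) φ) (ball 0 R) ∧
          ∀ p ∈ ball (0 : Pot k (sp K)) R,
            ‖(𝔇 K k).TF Z s ((t : ℝ) : ℂ) (cv κE (fun j : Fin (k + 1) => aw K k j) p) φ‖ ≤ weight L M c Z a s * Real.exp (a₅ * ((Z.1).card : ℝ)))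
    (hA0 : 0 ≤ c.C3act * c.ε₁) (hr₁ : 0 ≤ r₁) (hrate : r₁ + 2 * (64 * Real.log 162) + 2 ≤ (1 - 8 * c.δ) * ((c.L : ℝ) / 2) * c.κ)
    (hsmall : c.C3act * c.ε₁ * Real.exp (5 * r₁ + 1) * K₀ 64 8 * 9 * 64 ≤ 1) (hκr : κE ≤ r₁) (hrenew : Real.exp 1 * 9 * 64 * K₀ 64 8 ^ 2 * (c.C3act * c.ε₁) ≤ Mb)
    (hawpos : ∀ K k j, 0 < aw K k j) (hawcw : ∀ K k j, aw K k j ≤ cw) (hC1 : 4 * Mb * cw / ϱ < 1)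
    (hMb0 : 0 ≤ Mb) (hϱ : 0 < ϱ) (hR : cw * E₀ + ϱ < R)
    (hGt : ∀ (K k : ℕ), ∀ t ∈ Ioc (0 : ℝ) θ.γ, ∀ t' ∈ Ioc (0 : ℝ) θ.γ, ∀ (old : OlderTerms (F.P K) 𝔸 M k), old ∈ AdmHist (sp K) E₀ r₁ k ∧ old 0 = 0 →
      ∀ (X : (domSys (F.P K) M (k + 1)).Dom), ∀ φ ∈ sp K (k + 1) X,
        ‖((𝔇 K).Gn k).E ((t : ℝ) : ℂ) old φ X - ((𝔇 K).Gn k).E ((t' : ℝ) : ℂ) old φ X‖ ≤ Real.exp (-(κE * (domSys (F.P K) M (k + 1)).dj X)) * (lam K k * |t - t'|))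
    (hlam : ∀ K k, lam K k ≤ ℓ₁) (hℓ₁ : 0 ≤ ℓ₁)
    (hG2last : ∀ (K k : ℕ) (old : OlderTerms (F.P K) 𝔸 M k), old ∈ AdmHist (sp K) E₀ r₁ k ∧ old 0 = 0 → ∀ (t d : ℝ), 0 < d → t - d ∈ Ioc (0 : ℝ) θ.γ → t + d ∈ Ioc (0 : ℝ) θ.γ →
      ∀ (X : (domSys (F.P K) M (k + 1)).Dom), ∀ φ ∈ sp K (k + 1) X,
        ‖((𝔇 K).Gn k).E ((t + d : ℝ) : ℂ) old φ X - 2 * ((𝔇 K).Gn k).E ((t : ℝ) : ℂ) old φ X + ((𝔇 K).Gn k).E ((t - d : ℝ) : ℂ) old φ X‖ ≤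
          Real.exp (-(κE * (domSys (F.P K) M (k + 1)).dj X)) * (lam₂ K k * d ^ 2))
    (hlam₂ : ∀ K k, lam₂ K k ≤ ℓ₂) (hℓ₂ : 0 ≤ ℓ₂)
    (Ec : ℕ → ℕ → Type*) [∀ K k, NormedAddCommGroup (Ec K k)] [∀ K k, NormedSpace ℂ (Ec K k)]
    (ι : letI := θ.instVβ₁; letI := θ.instVβ₂
      (K k : ℕ) → (domSys (F.P K) M (k + 1)).Dom → ((Fin (F.P K).d → Site (F.P K) (k + 1) → θ.Vβ) →L[ℝ] Ec K k))
    (Φ : (K k : ℕ) → (domSys (F.P K) M (k + 1)).Dom → Ec K k → CPair (F.P K) 𝔸)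
    (U : (K k : ℕ) → (domSys (F.P K) M (k + 1)).Dom → Set (Ec K k)) (hU : ∀ K k X, IsOpen (U K k X)) (hrU : ∀ K k X, ball (0 : Ec K k) r ⊆ U K k X)
    (hEhol : ∀ g ∈ Window θ.γ, ∀ (K k : ℕ) (X : (domSys (F.P K) M (k + 1)).Dom),
      DifferentiableOn ℂ (fun z => (truncRun K (toClusterTower (𝔇 K).Gn) k).E (histPrefix g k) (Φ K k X z) X) (U K k X))
    (hΦemb : letI := θ.instVβ₁; letI := θ.instVβ₂
      ∀ (K k : ℕ) (X : (domSys (F.P K) M (k + 1)).Dom) (Bf : Fin (F.P K).d → Site (F.P K) (k + 1) → θ.Vβ),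
        Φ K k X (ι K k X Bf) = emb K k (fun l t => NormedSpace.exp (θ.ρ8 (Bf l t))))
    (hΦsp : ∀ (K k : ℕ) (X : (domSys (F.P K) M (k + 1)).Dom), ∀ z ∈ ball (0 : Ec K k) r, Φ K k X z ∈ sp K (k + 1) X)
    (w : (K k : ℕ) → (domSys (F.P K) M (k + 1)).Dom → Site (F.P K) (k + 1) → ℝ) (hw₀ : ∀ K k X t, 0 ≤ w K k X t)
    (hw : letI := θ.instVβ₁; letI := θ.instVβ₂; letI := θ.instιβ
      ∀ (K k : ℕ) (X : (domSys (F.P K) M (k + 1)).Dom) (l : Fin (F.P K).d) (t : Site (F.P K) (k + 1)) (c : θ.ιβ),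
        ‖ι K k X (Pi.single l (Pi.single t (θ.bV c)))‖ ≤ w K k X t)
    (htail : ∀ (K k : ℕ) (X : (domSys (F.P K) M (k + 1)).Dom) (t : Site (F.P K) (k + 1)),
      let e : Site (F.P K) (k + 1) → TPt 4 (domCount (F.P K) M (k + 1) * M) := fun x i => (ZMod.cast (x i) : ZMod (domCount (F.P K) M (k + 1) * M))
      w K k X t ≤ B₃ * Real.exp (-δ₀ * distCT (domCount (F.P K) M (k + 1)) M (e t) (nearT (M := M) (e t) X)))
    (hκ₅ : delta1 δ₀ κ ((M : ℝ) * 4) ≤ κ₅)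
    (hω : 0 < ℓ.ω) (hθω : ℓ.θ₅ ≤ ℓ.ω ^ 2) (hℓκ : ℓ.κ ≤ delta1 δ₀ κ ((M : ℝ) * 4))
    (hC₉ : (4 * (2 * C₅ / (1 - ℓ.θ₅) + 2 * ((16 * Mb * B₃ ^ 2 / r ^ 2) * Real.exp (delta1 δ₀ κ ((M : ℝ) * 4) * ((M : ℝ) * 4) * 3) * K₀ (4 * 2 ^ 4) (2 * 4) * K₁ 4 (δ₀ / 2))) / θ.γ +
        ((16 * max ℓ₂ (64 * Mb * cw ^ 2 / ϱ ^ 2 * ℓ₁ ^ 2 / (1 - 4 * Mb * cw / ϱ)) * B₃ ^ 2 / r ^ 2) * Real.exp (delta1 δ₀ κ ((M : ℝ) * 4) * ((M : ℝ) * 4) * 3) * K₀ (4 * 2 ^ 4) (2 * 4) *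
          K₁ 4 (δ₀ / 2)) * θ.γ / 2) / ℓ.ω ≤ ℓ.C₉) :
    NE9 ((objectsOfRecord₁₃ F N θ ℓ).EA 0) (Window θ.γ) ℓ.κ ℓ.moduli := by
  -- the admissibility class of this junction: def-W1's `AdmHist` AND a vanishing level-`0` slice (the run's level-`0` term is `0`, `recTerm_zero`, [I] (0.23))
  let Adm : (K k : ℕ) → OlderTerms (F.P K) 𝔸 M k → Prop := fun K k old => old ∈ AdmHist (sp K) E₀ r₁ k ∧ old 0 = 0
  have hAdm : ∀ K, ∀ g ∈ Window θ.γ, ∀ k, Adm K k (olderOf (recTerm (𝔇 K).Gn fun n => ((g n : ℝ) : ℂ)) k) := fun K g hg k =>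
    ⟨hRA K _ (fun n => hD K _ (hg n)) k, by funext X φ; simp [olderOf_apply, recTerm_zero]⟩
  -- N10 module 102 §4: the activity-level triple (H-fact) ∧ (H-holo) ∧ (H-38) for `(𝔇 K).Gn` at the table-germ reading
  have h3 := activityReading_termData_of_termwise226 F L 𝔇 (fun K k => sp K (k + 1)) Adm
    (Pot := fun K k => Pot k (sp K)) (fun K k => ρ (sp K) κE (fun j : Fin (k + 1) => aw K k j)) (fun K k => cv κE (fun j : Fin (k + 1) => aw K k j))
    c hL hLc hN (fun K k t ht old hold => hcv K k t ht old hold.1) hT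
  have hcw0 : ∀ K k, (0 : ℝ) ≤ cw := fun K k => (hawpos K k 0).le.trans (hawcw K k 0)
  -- N10 module 105's domination rows at ALL levels; the level-`0` entries of the class vanish
  have hρ₁ : ∀ (K k : ℕ) (o o' : OlderTerms (F.P K) 𝔸 M k), Adm K k o → Adm K k o' → ∀ (B' : ℝ), 0 ≤ B' →
      (∀ (k' : ℕ) (hk' : k' < k) (Y : (domSys (F.P K) M (k' + 1)).Dom), ∀ φ' ∈ sp K (k' + 1) Y,
        aw K k (k' + 1) * (Real.exp (κE * (domSys (F.P K) M (k' + 1)).dj Y) * ‖o ⟨k' + 1, Nat.succ_lt_succ hk'⟩ Y φ' - o' ⟨k' + 1, Nat.succ_lt_succ hk'⟩ Y φ'‖) ≤ B') →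
      ‖ρ (sp K) κE (fun j : Fin (k + 1) => aw K k j) o - ρ (sp K) κE (fun j : Fin (k + 1) => aw K k j) o'‖ ≤ B' := fun K k o o' ho ho' B' hB' h =>
    norm_ρ_sub_ρ_le κE (fun j : Fin (k + 1) => aw K k j) (hsp K) hκr hE₀ (fun j => (hawpos K k j).le) (fun j => hawcw K k j) ho.1 ho'.1 hB'
      fun j Y ψ hψ => by
        rcases Fin.eq_zero_or_eq_succ j with rfl | ⟨j', rfl⟩
        · simpa [ho.2, ho'.2] using hB'
        · exact h j'.1 j'.2 Y ψ hψ
  have hρ₂ : ∀ (K k : ℕ) (o₁ o₂ o₃ : OlderTerms (F.P K) 𝔸 M k), Adm K k o₁ → Adm K k o₂ → Adm K k o₃ → ∀ (B' : ℝ), 0 ≤ B' →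
      (∀ (k' : ℕ) (hk' : k' < k) (Y : (domSys (F.P K) M (k' + 1)).Dom), ∀ φ' ∈ sp K (k' + 1) Y,
        aw K k (k' + 1) * (Real.exp (κE * (domSys (F.P K) M (k' + 1)).dj Y) *
          ‖o₁ ⟨k' + 1, Nat.succ_lt_succ hk'⟩ Y φ' - 2 * o₂ ⟨k' + 1, Nat.succ_lt_succ hk'⟩ Y φ' + o₃ ⟨k' + 1, Nat.succ_lt_succ hk'⟩ Y φ'‖) ≤ B') →
      ‖ρ (sp K) κE (fun j : Fin (k + 1) => aw K k j) o₁ - (2 : ℂ) • ρ (sp K) κE (fun j : Fin (k + 1) => aw K k j) o₂ +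
        ρ (sp K) κE (fun j : Fin (k + 1) => aw K k j) o₃‖ ≤ B' := fun K k o₁ o₂ o₃ h₁ h₂ h₃ B' hB' h =>
    norm_ρ_threePoint_le κE (fun j : Fin (k + 1) => aw K k j) (hsp K) hκr hE₀ (fun j => (hawpos K k j).le) (fun j => hawcw K k j) h₁.1 h₂.1 h₃.1 hB'
      fun j Y ψ hψ => by
        rcases Fin.eq_zero_or_eq_succ j with rfl | ⟨j', rfl⟩
        · simpa [h₁.2, h₂.2, h₃.2] using hB'
        · exact h j'.1 j'.2 Y ψ hψ
  exact ne9_EA_objectsOfRecord₁₃_of_kernelStepRate_activityReadingLastSchemasNonexpansive F N θ ℓ hs hγ hlim hC₅ h5 m' M hM (fun K => (𝔇 K).Gn) emb hloc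
    (fun K k => sp K (k + 1)) hκ₀ hδ₀ hB₃ hr hκE Adm hAdm
    (Pot := fun K k => Pot k (sp K)) (fun K k => ρ (sp K) κE (fun j : Fin (k + 1) => aw K k j))
    (fun K k t φ (Z : (domSys (F.P K) M (k + 1)).Dom) (p : Pot k (sp K)) =>
      ∑ s ∈ terms L M Z, (𝔇 K k).TF Z s ((t : ℝ) : ℂ) (cv κE (fun j : Fin (k + 1) => aw K k j) p) φ)
    h3.1 h3.2.1 h3.2.2 hA0 hr₁ hrate hsmall hκr hrenew
    (fun K k old hold => norm_ρ_le_of_admHist κE (fun j : Fin (k + 1) => aw K k j) (hsp K) hκr hE₀ (fun j => (hawpos K k j).le)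
      (fun j => hawcw K k j) (hcw0 K k) hold.1)
    hρ₁ hρ₂ (fun K k j => (hawpos K k j).le) hawcw hC1 hMb0 hϱ hR hGt hlam hℓ₁ hG2last hlam₂ hℓ₂ Ec ι Φ U hU hrU hEhol hΦemb hΦsp w hw₀ hw htail hκ₅ hω hθω hℓκ hC₉

/-! ## §2 ★★★ schema-form twin of `ne9_EA_objectsOfRecord₁₃_of_kernelStepRate_termDataTableGermsLawsNonexpansive` -/

open Classical Finset in
/-- ★★★ **THE LAWS EDITION** (schema-form twin of module J68 §2): §1 with the reading section `hcv` DISCHARGED from def-W1's laws by N10 module 106 `𝒱_tableGerms_reading`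
(`UnscaledFieldLawOn`, `ReadsBy`, `MapsToTables … univ`, windows `W ⊇ sp K (k+1) X`); last coupling by the displayed schemas.  LOCATED; N22 NOT discharged. [folklore] -/
theorem ne9_EA_objectsOfRecord₁₃_of_kernelStepRate_termDataTableGermsLawsLastSchemasNonexpansive (θ : Stage13Params F N) (ℓ : U3Letters₁₁) (hs : ℓ.Signs) (hγ : 0 < θ.γ)
    (hlim : PolLimitsExistOfRecord₁₃ F N θ) {κ₅ C₅ : ℝ} (hC₅ : 0 ≤ C₅) (h5 : KernelStepRateOfRecord₁₃ F N θ κ₅ ℓ.θ₅ C₅)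
    (m' : ℕ) (M : ℕ) [NeZero M] (hM : M = F.L ^ m')
    {c₀ : B13.Consts} {L : ℕ} [NeZero L] (𝔇 : (K : ℕ) → TermData214 c₀ (F.P K) 𝔸 M L) (emb : ReadingMaps F (MatA N) 𝔸)
    (hloc : Localizes17OfRecord₁₃ F N θ (fun K => truncRun K (toClusterTower (𝔇 K).Gn)) emb)
    (sp : (K j : ℕ) → (domSys (F.P K) M j).Dom → Set (CPair (F.P K) 𝔸))
    (hsp : ∀ (K j : ℕ) (Y : (domSys (F.P K) M j).Dom), IsOpen (sp K j Y))
    {κ κE δ₀ B₃ r R E₀ ϱ Mb cw ℓ₁ ℓ₂ r₁ : ℝ} {aw : ℕ → ℕ → ℕ → ℝ} {lam lam₂ : ℕ → ℕ → ℝ}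
    (hκ₀ : kappa₀ (4 * 2 ^ 4) (2 * 4) ≤ κ / 2) (hδ₀ : 0 < δ₀) (hB₃ : 0 ≤ B₃) (hr : 0 < r) (hκE : κ ≤ κE) (hE₀ : 0 ≤ E₀)
    {D : ℕ → Set ℂ} (hRA : ∀ K, RecAdmissible (𝔇 K).Gn (D K) (AdmHist (sp K) E₀ r₁))
    (hD : ∀ K, ∀ t ∈ Ioc (0 : ℝ) θ.γ, ((t : ℝ) : ℂ) ∈ D K)
    {S : ℕ → ℕ → Type} [∀ K k, MeasurableSpace (S K k)]
    (χu χcu : (K k : ℕ) → (𝔇 K k).UnscaledChi) (𝒲 : (K k : ℕ) → (𝔇 K k).UnscaledWilson) (𝒪 : (K k : ℕ) → (𝔇 K k).UnscaledOlder)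
    (Rd : (K k : ℕ) → (Z : (domSys (F.P K) M (k + 1)).Dom) → (t : TermLabel (F.P K) M k L) → (𝔇 K k).ReadingAtoms Z t (S K k))
    (W : (K k : ℕ) → (domSys (F.P K) M (k + 1)).Dom → TermLabel (F.P K) M k L → Set (CPair (F.P K) 𝔸))
    (hlaw : ∀ K, (𝔇 K).UnscaledFieldLawOn (χu K) (χcu K) (𝒲 K) (𝒪 K) θ.γ) (hread : ∀ K k, (𝔇 K k).ReadsBy (𝒪 K k) (Rd K k))
    (hmaps : ∀ (K k : ℕ) (Z : (domSys (F.P K) M (k + 1)).Dom) (t : TermLabel (F.P K) M k L), (Rd K k Z t).MapsToTables (sp K) (W K k Z t) univ)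
    (hW : ∀ (K k : ℕ) (X Z : (domSys (F.P K) M (k + 1)).Dom), Subtype.val Z ⊆ Subtype.val X → ∀ s ∈ terms L M Z, sp K (k + 1) X ⊆ W K k Z s)
    (c : B13.Consts) (hL : 8 ≤ c.L) (hLc : c.L = L) {a a₂ a₂' a₅ Aabs : ℝ} (hN : Lemma3Numerics c M ((c.L : ℝ) / 2) a a₂ a₂' a₅ Aabs)
    (hT : ∀ (K k : ℕ), ∀ t ∈ Ioc (0 : ℝ) θ.γ, ∀ (X : (domSys (F.P K) M (k + 1)).Dom), ∀ φ ∈ sp K (k + 1) X,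
      ∀ Z : (domSys (F.P K) M (k + 1)).Dom, Subtype.val Z ⊆ Subtype.val X → ∀ s ∈ terms L M Z,
        DifferentiableOn ℂ (fun p : Pot k (sp K) => (𝔇 K k).TF Z s ((t : ℝ) : ℂ) (cv κE (fun j : Fin (k + 1) => aw K k j) p) φ) (ball 0 R) ∧
          ∀ p ∈ ball (0 : Pot k (sp K)) R,
            ‖(𝔇 K k).TF Z s ((t : ℝ) : ℂ) (cv κE (fun j : Fin (k + 1) => aw K k j) p) φ‖ ≤ weight L M c Z a s * Real.exp (a₅ * ((Z.1).card : ℝ)))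
    (hA0 : 0 ≤ c.C3act * c.ε₁) (hr₁ : 0 ≤ r₁) (hrate : r₁ + 2 * (64 * Real.log 162) + 2 ≤ (1 - 8 * c.δ) * ((c.L : ℝ) / 2) * c.κ)
    (hsmall : c.C3act * c.ε₁ * Real.exp (5 * r₁ + 1) * K₀ 64 8 * 9 * 64 ≤ 1) (hκr : κE ≤ r₁) (hrenew : Real.exp 1 * 9 * 64 * K₀ 64 8 ^ 2 * (c.C3act * c.ε₁) ≤ Mb)
    (hawpos : ∀ K k j, 0 < aw K k j) (hawcw : ∀ K k j, aw K k j ≤ cw) (hC1 : 4 * Mb * cw / ϱ < 1)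
    (hMb0 : 0 ≤ Mb) (hϱ : 0 < ϱ) (hR : cw * E₀ + ϱ < R)
    (hGt : ∀ (K k : ℕ), ∀ t ∈ Ioc (0 : ℝ) θ.γ, ∀ t' ∈ Ioc (0 : ℝ) θ.γ, ∀ (old : OlderTerms (F.P K) 𝔸 M k), old ∈ AdmHist (sp K) E₀ r₁ k ∧ old 0 = 0 →
      ∀ (X : (domSys (F.P K) M (k + 1)).Dom), ∀ φ ∈ sp K (k + 1) X,
        ‖((𝔇 K).Gn k).E ((t : ℝ) : ℂ) old φ X - ((𝔇 K).Gn k).E ((t' : ℝ) : ℂ) old φ X‖ ≤ Real.exp (-(κE * (domSys (F.P K) M (k + 1)).dj X)) * (lam K k * |t - t'|))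
    (hlam : ∀ K k, lam K k ≤ ℓ₁) (hℓ₁ : 0 ≤ ℓ₁)
    (hG2last : ∀ (K k : ℕ) (old : OlderTerms (F.P K) 𝔸 M k), old ∈ AdmHist (sp K) E₀ r₁ k ∧ old 0 = 0 → ∀ (t d : ℝ), 0 < d → t - d ∈ Ioc (0 : ℝ) θ.γ → t + d ∈ Ioc (0 : ℝ) θ.γ →
      ∀ (X : (domSys (F.P K) M (k + 1)).Dom), ∀ φ ∈ sp K (k + 1) X,
        ‖((𝔇 K).Gn k).E ((t + d : ℝ) : ℂ) old φ X - 2 * ((𝔇 K).Gn k).E ((t : ℝ) : ℂ) old φ X + ((𝔇 K).Gn k).E ((t - d : ℝ) : ℂ) old φ X‖ ≤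
          Real.exp (-(κE * (domSys (F.P K) M (k + 1)).dj X)) * (lam₂ K k * d ^ 2))
    (hlam₂ : ∀ K k, lam₂ K k ≤ ℓ₂) (hℓ₂ : 0 ≤ ℓ₂)
    (Ec : ℕ → ℕ → Type*) [∀ K k, NormedAddCommGroup (Ec K k)] [∀ K k, NormedSpace ℂ (Ec K k)]
    (ι : letI := θ.instVβ₁; letI := θ.instVβ₂
      (K k : ℕ) → (domSys (F.P K) M (k + 1)).Dom → ((Fin (F.P K).d → Site (F.P K) (k + 1) → θ.Vβ) →L[ℝ] Ec K k))
    (Φ : (K k : ℕ) → (domSys (F.P K) M (k + 1)).Dom → Ec K k → CPair (F.P K) 𝔸)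
    (U : (K k : ℕ) → (domSys (F.P K) M (k + 1)).Dom → Set (Ec K k)) (hU : ∀ K k X, IsOpen (U K k X)) (hrU : ∀ K k X, ball (0 : Ec K k) r ⊆ U K k X)
    (hEhol : ∀ g ∈ Window θ.γ, ∀ (K k : ℕ) (X : (domSys (F.P K) M (k + 1)).Dom),
      DifferentiableOn ℂ (fun z => (truncRun K (toClusterTower (𝔇 K).Gn) k).E (histPrefix g k) (Φ K k X z) X) (U K k X))
    (hΦemb : letI := θ.instVβ₁; letI := θ.instVβ₂
      ∀ (K k : ℕ) (X : (domSys (F.P K) M (k + 1)).Dom) (Bf : Fin (F.P K).d → Site (F.P K) (k + 1) → θ.Vβ),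
        Φ K k X (ι K k X Bf) = emb K k (fun l t => NormedSpace.exp (θ.ρ8 (Bf l t))))
    (hΦsp : ∀ (K k : ℕ) (X : (domSys (F.P K) M (k + 1)).Dom), ∀ z ∈ ball (0 : Ec K k) r, Φ K k X z ∈ sp K (k + 1) X)
    (w : (K k : ℕ) → (domSys (F.P K) M (k + 1)).Dom → Site (F.P K) (k + 1) → ℝ) (hw₀ : ∀ K k X t, 0 ≤ w K k X t)
    (hw : letI := θ.instVβ₁; letI := θ.instVβ₂; letI := θ.instιβ
      ∀ (K k : ℕ) (X : (domSys (F.P K) M (k + 1)).Dom) (l : Fin (F.P K).d) (t : Site (F.P K) (k + 1)) (c : θ.ιβ),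
        ‖ι K k X (Pi.single l (Pi.single t (θ.bV c)))‖ ≤ w K k X t)
    (htail : ∀ (K k : ℕ) (X : (domSys (F.P K) M (k + 1)).Dom) (t : Site (F.P K) (k + 1)),
      let e : Site (F.P K) (k + 1) → TPt 4 (domCount (F.P K) M (k + 1) * M) := fun x i => (ZMod.cast (x i) : ZMod (domCount (F.P K) M (k + 1) * M))
      w K k X t ≤ B₃ * Real.exp (-δ₀ * distCT (domCount (F.P K) M (k + 1)) M (e t) (nearT (M := M) (e t) X)))
    (hκ₅ : delta1 δ₀ κ ((M : ℝ) * 4) ≤ κ₅)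
    (hω : 0 < ℓ.ω) (hθω : ℓ.θ₅ ≤ ℓ.ω ^ 2) (hℓκ : ℓ.κ ≤ delta1 δ₀ κ ((M : ℝ) * 4))
    (hC₉ : (4 * (2 * C₅ / (1 - ℓ.θ₅) + 2 * ((16 * Mb * B₃ ^ 2 / r ^ 2) * Real.exp (delta1 δ₀ κ ((M : ℝ) * 4) * ((M : ℝ) * 4) * 3) * K₀ (4 * 2 ^ 4) (2 * 4) * K₁ 4 (δ₀ / 2))) / θ.γ +
        ((16 * max ℓ₂ (64 * Mb * cw ^ 2 / ϱ ^ 2 * ℓ₁ ^ 2 / (1 - 4 * Mb * cw / ϱ)) * B₃ ^ 2 / r ^ 2) * Real.exp (delta1 δ₀ κ ((M : ℝ) * 4) * ((M : ℝ) * 4) * 3) * K₀ (4 * 2 ^ 4) (2 * 4) *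
          K₁ 4 (δ₀ / 2)) * θ.γ / 2) / ℓ.ω ≤ ℓ.C₉) :
    NE9 ((objectsOfRecord₁₃ F N θ ℓ).EA 0) (Window θ.γ) ℓ.κ ℓ.moduli :=
  ne9_EA_objectsOfRecord₁₃_of_kernelStepRate_termDataTableGermsLastSchemasNonexpansive F N
    θ ℓ hs hγ hlim hC₅ h5 m' M hM 𝔇 emb hloc sp hsp hκ₀ hδ₀ hB₃ hr hκE hE₀ hRA hD
    (fun K k _ ht _ hold X _ hφ Z hZ s hs' Y B => 𝒱_tableGerms_reading (𝔇 K k) (sp K) κE (fun j : Fin (k + 1) => aw K k j) (Rd K k) (W K k)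
        (hlaw K k) (hread K k) (hmaps K k) (hsp K) hκr hE₀ (fun j => hawpos K k j) (fun j => hawcw K k j) ht hold (hW K k X Z hZ s hs' hφ) Y B)
    c hL hLc hN hT hA0 hr₁ hrate hsmall hκr hrenew hawpos hawcw hC1 hMb0 hϱ hR hGt hlam hℓ₁ hG2last hlam₂ hℓ₂ Ec ι Φ U hU hrU hEhol hΦemb hΦsp w hw₀ hw htail hκ₅ hω hθω
    hℓκ hC₉

end YMDAG.N22.KernelFading

end
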